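import Summits.QuantumFields.YangMills.Theorems.PoincareLipschitzRadialCutoffLetters
import Mathlib.Analysis.Calculus.ParametricIntegral
import Mathlib.Analysis.Calculus.Deriv.MeanValue
import Mathlib.Analysis.Calculus.Deriv.Inv
import Mathlib.MeasureTheory.Integral.Bochner.Set
import Mathlib.MeasureTheory.Measure.Haar.InnerProductSpace
import HarnessLib

/-!
# Crux `BlockLipschitzL` (stmt-QuantumFields-23533) ∕ `HistoryTailL` (stmt-QuantumFields-19936), LINE 25 «CompactnessTransfer»,
# S1″ row (M) — (δ2) «MONOTONICITY FROM THE RADIAL INEQUALITY»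

Cell `ym3-torus` (YM ladder rung R3 = continuum SU(2) Yang–Mills on T³ — a RUNG, NOT the Clay problem: not d = 4, not
infinite volume, not a mass gap); WIDTH helper seat `ym-ust-19936-w3` g15, the (δ2) half of the (M)-PROOF lane led by seat
w2 g13 ((α) axial shears ⧗p721131, (β) weak chain rule under a shear, (γ) axial stationarity of ball minimisers, (δ1) the radial
identity — w2; (δ2) — this file).  Helper `--supports stmt-QuantumFields-23533`; THEOREMS ONLY (0 `def`, 0 `sorry`, default
heartbeats); imports ✓`PoincareLipschitzRadialCutoffLetters` (the cutoff `g_κ(s) = smoothTransition((1−s)∕κ)` letters) + Mathlib.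

THE STEP [Simon1996, §2.4].  For an energy density `dens = Σᵢ‖G eᵢ‖²` integrable on `B_ρ(y)`, the weighted energies
`φ_κ(τ) := τ⁻¹·∫_{B_ρ(y)} g_κ(‖x−y‖²∕τ²)·dens dx` satisfy `φ_κ′(τ) = −τ⁻²·∫ (g_κ + 2s·g_κ′)(‖x−y‖²∕τ²)·dens` (dominated
differentiation under the integral, `hasDerivAt_integral_of_dominated_loc_of_deriv_le`; NO coarea, NO `∂B_ρ` traces).  The RADIAL
INEQUALITY `∫ (g_κ + 2s·g_κ′)(‖x−y‖²∕τ²)·dens ≤ 0` (`0 < κ < 1`, `0 < τ < ρ`) — which is the stationarity identity (v) of [Simon1996,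
§2.2] tested against the inner variations `ζ(x) = g_κ(‖x−y‖²∕τ²)(x − y)` and summed over the three axes, i.e. w2 g13's (δ1) «radial
identity» `= (4∕τ²)∫ g_κ′·‖G(x−y)‖²` plus `g_κ′ ≤ 0` — then makes every `φ_κ` non-decreasing on `(0, ρ)`; the sandwich
`√(1−κ)·σ⁻¹E(B_σ) ≤ φ_κ(σ∕√(1−κ)) ≤ φ_κ(τ₁) ≤ τ₁⁻¹E(B_ρ)` and the scalar limits `τ₁ ↑ ρ`, `κ ↓ 0` give the monotonicity of
`ρ ↦ ρ⁻¹E(B_ρ(y))` — the consequent of the (M)-row binder `hMono` of ✓`PoincareLipschitzUniformSmallScaleEnergyOfRows` (⧗p720843).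

WHAT IS PROVED (ns `…Theorems.PoincareLipschitzMonotonicityOfRadialInequality`).
* §1 `hasDerivAt_kernel` (`d∕dτ[g(s∕τ²)·τ⁻¹] = −τ⁻²(g + 2(s∕τ²)g′)(s∕τ²)`), `continuous_radialProfile`.
* §2 `exists_bound_cutoff_deriv`, ★ `hasDerivAt_weightedEnergy` (the `τ`-derivative of `φ_κ`, any `κ`, any `τ₀ > 0`).
* §3 `integrable_weighted`, ★★ `weightedEnergy_monotoneOn` (radial inequality on `(0,ρ)` ⇒ `φ_κ` non-decreasing on `(0,ρ)`).
* §4 ★★★ `monotonicity_of_radialInequality (hρ) (G) (hGi) (hRad) (σ) (hσ) (hσρ) :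
  σ⁻¹ * ∫ x in ball y σ, Σᵢ‖G x eᵢ‖² ≤ ρ⁻¹ * ∫ x in ball y ρ, Σᵢ‖G x eᵢ‖²`.
HONEST SCOPE.  One step of the (M)-PROOF; (M) itself needs (β)(γ)(δ1) (w2 g13); (C), (R), S1″, S2♭″, `hHalvingBand`,
`BlockLipschitzL`, `HistoryTailL` are NOT proved here.  YM₃ on T³ is rung R3, not Clay; YM gap NOT proved; no summit statement
is proved here.

References: L. Simon, Theorems on Regularity and Singularity of Energy Minimizing Maps (1996) [Simon1996] (§2.2 (v), §2.4 (i)–(ii));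
P. Price, A monotonicity formula for Yang–Mills fields, Manuscripta Math. 43 (1983) (the weighted-cutoff road).
-/

set_option autoImplicit false

noncomputable section
open scoped BigOperators Topology RealInnerProductSpace
open MeasureTheory Set Filter Metric
open Summit.QuantumFields.YangMills.Theorems.PoincareLipschitzRadialCutoffLetters

namespace Summit.QuantumFields.YangMills.Theorems.PoincareLipschitzMonotonicityOfRadialInequality

/-! ### §1 The kernel `τ ↦ g(s∕τ²)∕τ` and its `τ`-derivative -/

/-- `d∕dτ [g(s∕τ²)·τ⁻¹] = −τ⁻²·(g(s∕τ²) + 2(s∕τ²)·g′(s∕τ²))` for `τ ≠ 0`. [folklore] -/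
theorem hasDerivAt_kernel {g : ℝ → ℝ} (hg : Differentiable ℝ g) (s : ℝ) {τ : ℝ} (hτ : τ ≠ 0) :
    HasDerivAt (fun τ : ℝ => g (s / τ ^ 2) * τ⁻¹)
      (-(τ ^ 2)⁻¹ * (g (s / τ ^ 2) + 2 * (s / τ ^ 2) * deriv g (s / τ ^ 2))) τ := by
  have h1 : HasDerivAt (fun τ : ℝ => s / τ ^ 2) ((0 * τ ^ 2 - s * (↑(2:ℕ) * τ ^ (2 - 1))) / (τ ^ 2) ^ 2) τ :=
    (hasDerivAt_const τ s).div (hasDerivAt_pow 2 τ) (pow_ne_zero 2 hτ)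
  have h2 := ((hg (s / τ ^ 2)).hasDerivAt).comp τ h1
  have h3 := h2.mul (hasDerivAt_inv hτ)
  refine h3.congr_deriv ?_
  simp only [Function.comp_apply, Nat.cast_ofNat]
  field_simp
  ring

/-- The kernel is continuous in `x`. [folklore] -/
theorem continuous_radialProfile {g : ℝ → ℝ} (hg : Continuous g) (y : EuclideanSpace ℝ (Fin 3)) (τ : ℝ) :
    Continuous (fun x : EuclideanSpace ℝ (Fin 3) => g (‖x - y‖ ^ 2 / τ ^ 2)) :=
  hg.comp (((continuous_id.sub continuous_const).norm.pow 2).div_const _)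

/-! ### §2 Differentiating the weighted energy `φ_κ(τ) = ∫_{B_ρ(y)} g_κ(‖x−y‖²∕τ²)·τ⁻¹·dens` in `τ` -/

/-- A uniform bound for `|g_κ′|` on a compact range `[0, S]`. [folklore] -/
theorem exists_bound_cutoff_deriv (κ S : ℝ) :
    ∃ M : ℝ, 0 ≤ M ∧ ∀ s ∈ Icc (0:ℝ) S, |deriv (fun s : ℝ => Real.smoothTransition ((1 - s) / κ)) s| ≤ M := by
  obtain ⟨M, hM⟩ := (isCompact_Icc (a := (0:ℝ)) (b := S)).exists_bound_of_continuousOn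
    ((cutoff_deriv_continuous κ).continuousOn)
  refine ⟨max M 0, le_max_right _ _, fun s hs => ?_⟩
  have := hM s hs
  rw [Real.norm_eq_abs] at this
  exact this.trans (le_max_left _ _)

/-- ★ The `τ`-derivative of the weighted energy (dominated differentiation under the integral; no use of `τ < ρ`).
[cite: Simon1996, §2.4 (proof of the monotonicity identity)] -/
theorem hasDerivAt_weightedEnergy (y : EuclideanSpace ℝ (Fin 3)) {ρ : ℝ} (hρ : 0 < ρ)
    (G : EuclideanSpace ℝ (Fin 3) → (EuclideanSpace ℝ (Fin 3) →L[ℝ] EuclideanSpace ℝ (Fin 4)))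
    (hGi : IntegrableOn (fun x => ∑ i : Fin 3, ‖G x (EuclideanSpace.single i (1:ℝ))‖ ^ 2) (ball y ρ))
    (κ : ℝ) {τ₀ : ℝ} (hτ₀ : 0 < τ₀) :
    HasDerivAt (fun τ : ℝ => ∫ x in ball y ρ, Real.smoothTransition ((1 - ‖x - y‖ ^ 2 / τ ^ 2) / κ) * τ⁻¹ *
        ∑ i : Fin 3, ‖G x (EuclideanSpace.single i (1:ℝ))‖ ^ 2)
      (∫ x in ball y ρ, (-(τ₀ ^ 2)⁻¹ * (Real.smoothTransition ((1 - ‖x - y‖ ^ 2 / τ₀ ^ 2) / κ) +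
          2 * (‖x - y‖ ^ 2 / τ₀ ^ 2) * deriv (fun s : ℝ => Real.smoothTransition ((1 - s) / κ)) (‖x - y‖ ^ 2 / τ₀ ^ 2))) *
        ∑ i : Fin 3, ‖G x (EuclideanSpace.single i (1:ℝ))‖ ^ 2) τ₀ := by
  -- abbreviations (local, by `set`)
  set gκ : ℝ → ℝ := fun s => Real.smoothTransition ((1 - s) / κ) with hgκ
  set dens : EuclideanSpace ℝ (Fin 3) → ℝ := fun x => ∑ i : Fin 3, ‖G x (EuclideanSpace.single i (1:ℝ))‖ ^ 2 with hdens
  have hg_diff : Differentiable ℝ gκ := (cutoff_contDiff κ (n := 1)).differentiable (by simp)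
  have hg_cont : Continuous gκ := hg_diff.continuous
  have hdens_nn : ∀ x, 0 ≤ dens x := fun x => Finset.sum_nonneg fun i _ => by positivity
  -- the bound on `|g′|` over the relevant range
  set S : ℝ := ρ ^ 2 / (τ₀ / 2) ^ 2 with hS
  obtain ⟨M, hM0, hM⟩ := exists_bound_cutoff_deriv κ S
  set C : ℝ := ((τ₀ / 2) ^ 2)⁻¹ * (1 + 2 * S * M) with hC
  have key := hasDerivAt_integral_of_dominated_loc_of_deriv_le (μ := volume.restrict (ball y ρ))
    (F := fun τ x => gκ (‖x - y‖ ^ 2 / τ ^ 2) * τ⁻¹ * dens x)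
    (F' := fun τ x => (-(τ ^ 2)⁻¹ * (gκ (‖x - y‖ ^ 2 / τ ^ 2) +
          2 * (‖x - y‖ ^ 2 / τ ^ 2) * deriv gκ (‖x - y‖ ^ 2 / τ ^ 2))) * dens x)
    (x₀ := τ₀) (bound := fun x => C * dens x) (s := Ioi (τ₀ / 2)) (Ioi_mem_nhds (by linarith)) ?_ ?_ ?_ ?_ ?_ ?_
  · exact key.2
  · -- measurability of `F τ` for every `τ`
    refine Eventually.of_forall fun τ => ?_
    exact (((continuous_radialProfile hg_cont y τ).mul continuous_const).aestronglyMeasurable).mul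
      hGi.aestronglyMeasurable
  · -- integrability of `F τ₀`: `|F| ≤ τ₀⁻¹·dens`
    refine Integrable.mono' (hGi.const_mul τ₀⁻¹) ?_ ?_
    · exact (((continuous_radialProfile hg_cont y τ₀).mul continuous_const).aestronglyMeasurable).mul
        hGi.aestronglyMeasurable
    · refine Eventually.of_forall fun x => ?_
      rw [Real.norm_eq_abs, abs_mul, abs_mul, abs_of_nonneg (hdens_nn x), abs_of_pos (inv_pos.mpr hτ₀)]
      have h1 : |gκ (‖x - y‖ ^ 2 / τ₀ ^ 2)| ≤ 1 := by
        rw [abs_of_nonneg (cutoff_mem_Icc κ _).1]; exact (cutoff_mem_Icc κ _).2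
      calc |gκ (‖x - y‖ ^ 2 / τ₀ ^ 2)| * τ₀⁻¹ * dens x ≤ 1 * τ₀⁻¹ * dens x := by gcongr
        _ = τ₀⁻¹ * dens x := by ring
  · -- measurability of `F' τ₀`
    have hc1 : Continuous fun x : EuclideanSpace ℝ (Fin 3) => ‖x - y‖ ^ 2 / τ₀ ^ 2 :=
      ((continuous_id.sub continuous_const).norm.pow 2).div_const _
    have hc2 : Continuous fun x : EuclideanSpace ℝ (Fin 3) => deriv gκ (‖x - y‖ ^ 2 / τ₀ ^ 2) :=
      (cutoff_deriv_continuous κ).comp hc1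
    exact ((continuous_const.mul (((continuous_radialProfile hg_cont y τ₀)).add
      ((continuous_const.mul hc1).mul hc2))).aestronglyMeasurable).mul hGi.aestronglyMeasurable
  · -- the domination `|F′ τ x| ≤ C·dens x` for `τ > τ₀∕2`, `x ∈ B_ρ(y)`
    filter_upwards [ae_restrict_mem measurableSet_ball] with x hx τ hτ
    rw [mem_Ioi] at hτ
    have hτpos : 0 < τ := by linarith
    have hxy : ‖x - y‖ < ρ := by rwa [mem_ball, dist_eq_norm] at hx
    have hq0 : 0 ≤ ‖x - y‖ ^ 2 / τ ^ 2 := by positivity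
    have hqS : ‖x - y‖ ^ 2 / τ ^ 2 ≤ S := by
      rw [hS, div_le_div_iff₀ (by positivity) (by positivity)]
      have h1 : ‖x - y‖ ^ 2 ≤ ρ ^ 2 := pow_le_pow_left₀ (norm_nonneg _) hxy.le 2
      have h2 : (τ₀ / 2) ^ 2 ≤ τ ^ 2 := pow_le_pow_left₀ (by linarith) hτ.le 2
      calc ‖x - y‖ ^ 2 * (τ₀ / 2) ^ 2 ≤ ρ ^ 2 * τ ^ 2 := mul_le_mul h1 h2 (by positivity) (by positivity)
        _ = ρ ^ 2 * τ ^ 2 := rfl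
    have hg1 : |gκ (‖x - y‖ ^ 2 / τ ^ 2)| ≤ 1 := by
      rw [abs_of_nonneg (cutoff_mem_Icc κ _).1]; exact (cutoff_mem_Icc κ _).2
    have hg2 : |deriv gκ (‖x - y‖ ^ 2 / τ ^ 2)| ≤ M := hM _ ⟨hq0, hqS⟩
    have hτinv : (τ ^ 2)⁻¹ ≤ ((τ₀ / 2) ^ 2)⁻¹ := by
      apply inv_anti₀ (by positivity)
      exact pow_le_pow_left₀ (by linarith) hτ.le 2
    rw [Real.norm_eq_abs, abs_mul, abs_of_nonneg (hdens_nn x), hC]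
    refine mul_le_mul_of_nonneg_right ?_ (hdens_nn x)
    rw [abs_mul, abs_neg, abs_of_pos (inv_pos.mpr (by positivity))]
    refine mul_le_mul hτinv ?_ (abs_nonneg _) (by positivity)
    calc |gκ (‖x - y‖ ^ 2 / τ ^ 2) + 2 * (‖x - y‖ ^ 2 / τ ^ 2) * deriv gκ (‖x - y‖ ^ 2 / τ ^ 2)|
        ≤ |gκ (‖x - y‖ ^ 2 / τ ^ 2)| + |2 * (‖x - y‖ ^ 2 / τ ^ 2) * deriv gκ (‖x - y‖ ^ 2 / τ ^ 2)| := abs_add_le _ _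
      _ ≤ 1 + 2 * S * M := by
          rw [abs_mul, abs_mul, abs_of_pos (by norm_num : (0:ℝ) < 2), abs_of_nonneg hq0]
          gcongr
  · exact hGi.const_mul C
  · -- pointwise differentiability in `τ`
    filter_upwards with x τ hτ
    rw [mem_Ioi] at hτ
    have hτne : τ ≠ 0 := by linarith
    exact (hasDerivAt_kernel hg_diff (‖x - y‖ ^ 2) hτne).mul_const (dens x)

/-! ### §3 Monotonicity of the weighted energy from the radial inequality -/

/-- The weighted energy integrand is integrable on the ball (`0 ≤ g_κ ≤ 1`). [folklore] -/
theorem integrable_weighted (y : EuclideanSpace ℝ (Fin 3)) (ρ : ℝ)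
    (G : EuclideanSpace ℝ (Fin 3) → (EuclideanSpace ℝ (Fin 3) →L[ℝ] EuclideanSpace ℝ (Fin 4)))
    (hGi : IntegrableOn (fun x => ∑ i : Fin 3, ‖G x (EuclideanSpace.single i (1:ℝ))‖ ^ 2) (ball y ρ))
    (κ τ : ℝ) :
    IntegrableOn (fun x : EuclideanSpace ℝ (Fin 3) => Real.smoothTransition ((1 - ‖x - y‖ ^ 2 / τ ^ 2) / κ) * τ⁻¹ *
        ∑ i : Fin 3, ‖G x (EuclideanSpace.single i (1:ℝ))‖ ^ 2) (ball y ρ) := by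
  have hg_cont : Continuous (fun s : ℝ => Real.smoothTransition ((1 - s) / κ)) :=
    (cutoff_contDiff κ (n := 0)).continuous
  refine Integrable.mono' (hGi.const_mul |τ⁻¹|) ?_ ?_
  · exact (((continuous_radialProfile hg_cont y τ).mul continuous_const).aestronglyMeasurable).mul
      hGi.aestronglyMeasurable
  · refine Eventually.of_forall fun x => ?_
    have hd : 0 ≤ ∑ i : Fin 3, ‖G x (EuclideanSpace.single i (1:ℝ))‖ ^ 2 := Finset.sum_nonneg fun i _ => by positivity
    rw [Real.norm_eq_abs, abs_mul, abs_mul, abs_of_nonneg hd, abs_of_nonneg (cutoff_mem_Icc κ _).1]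
    have h1 : Real.smoothTransition ((1 - ‖x - y‖ ^ 2 / τ ^ 2) / κ) ≤ 1 := (cutoff_mem_Icc κ _).2
    calc Real.smoothTransition ((1 - ‖x - y‖ ^ 2 / τ ^ 2) / κ) * |τ⁻¹| * ∑ i : Fin 3, ‖G x (EuclideanSpace.single i (1:ℝ))‖ ^ 2
        ≤ 1 * |τ⁻¹| * ∑ i : Fin 3, ‖G x (EuclideanSpace.single i (1:ℝ))‖ ^ 2 := by gcongr
      _ = |τ⁻¹| * ∑ i : Fin 3, ‖G x (EuclideanSpace.single i (1:ℝ))‖ ^ 2 := by ring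

/-- ★★ The weighted energy `τ ↦ ∫_{B_ρ(y)} g_κ(‖x−y‖²∕τ²)·τ⁻¹·dens` is non-decreasing on `(0, ρ)` as soon as the RADIAL INEQUALITY
`∫_{B_ρ(y)} (g_κ + 2s·g_κ′)(‖x−y‖²∕τ²)·dens ≤ 0` holds for every `τ ∈ (0, ρ)` (stationarity summed over the axes, [Simon1996 §2.4]).
[cite: Simon1996, §2.4 (ii)] -/
theorem weightedEnergy_monotoneOn (y : EuclideanSpace ℝ (Fin 3)) {ρ : ℝ} (hρ : 0 < ρ)
    (G : EuclideanSpace ℝ (Fin 3) → (EuclideanSpace ℝ (Fin 3) →L[ℝ] EuclideanSpace ℝ (Fin 4)))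
    (hGi : IntegrableOn (fun x => ∑ i : Fin 3, ‖G x (EuclideanSpace.single i (1:ℝ))‖ ^ 2) (ball y ρ))
    (κ : ℝ)
    (hRad : ∀ τ : ℝ, 0 < τ → τ < ρ →
      ∫ x in ball y ρ, (Real.smoothTransition ((1 - ‖x - y‖ ^ 2 / τ ^ 2) / κ) +
          2 * (‖x - y‖ ^ 2 / τ ^ 2) * deriv (fun s : ℝ => Real.smoothTransition ((1 - s) / κ)) (‖x - y‖ ^ 2 / τ ^ 2)) *
        ∑ i : Fin 3, ‖G x (EuclideanSpace.single i (1:ℝ))‖ ^ 2 ≤ 0) :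
    MonotoneOn (fun τ : ℝ => ∫ x in ball y ρ, Real.smoothTransition ((1 - ‖x - y‖ ^ 2 / τ ^ 2) / κ) * τ⁻¹ *
        ∑ i : Fin 3, ‖G x (EuclideanSpace.single i (1:ℝ))‖ ^ 2) (Ioo 0 ρ) := by
  have hD : ∀ τ ∈ Ioo 0 ρ, HasDerivAt (fun τ : ℝ => ∫ x in ball y ρ,
      Real.smoothTransition ((1 - ‖x - y‖ ^ 2 / τ ^ 2) / κ) * τ⁻¹ * ∑ i : Fin 3, ‖G x (EuclideanSpace.single i (1:ℝ))‖ ^ 2)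
      (∫ x in ball y ρ, (-(τ ^ 2)⁻¹ * (Real.smoothTransition ((1 - ‖x - y‖ ^ 2 / τ ^ 2) / κ) +
          2 * (‖x - y‖ ^ 2 / τ ^ 2) * deriv (fun s : ℝ => Real.smoothTransition ((1 - s) / κ)) (‖x - y‖ ^ 2 / τ ^ 2))) *
        ∑ i : Fin 3, ‖G x (EuclideanSpace.single i (1:ℝ))‖ ^ 2) τ :=
    fun τ hτ => hasDerivAt_weightedEnergy y hρ G hGi κ hτ.1
  refine monotoneOn_of_deriv_nonneg (convex_Ioo 0 ρ) ?_ ?_ ?_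
  · exact fun τ hτ => (hD τ hτ).continuousAt.continuousWithinAt
  · rw [interior_Ioo]; exact fun τ hτ => (hD τ hτ).differentiableAt.differentiableWithinAt
  · rw [interior_Ioo]
    intro τ hτ
    rw [(hD τ hτ).deriv]
    have hsplit : ∫ x in ball y ρ, (-(τ ^ 2)⁻¹ * (Real.smoothTransition ((1 - ‖x - y‖ ^ 2 / τ ^ 2) / κ) +
          2 * (‖x - y‖ ^ 2 / τ ^ 2) * deriv (fun s : ℝ => Real.smoothTransition ((1 - s) / κ)) (‖x - y‖ ^ 2 / τ ^ 2))) *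
        ∑ i : Fin 3, ‖G x (EuclideanSpace.single i (1:ℝ))‖ ^ 2 =
        -(τ ^ 2)⁻¹ * ∫ x in ball y ρ, (Real.smoothTransition ((1 - ‖x - y‖ ^ 2 / τ ^ 2) / κ) +
          2 * (‖x - y‖ ^ 2 / τ ^ 2) * deriv (fun s : ℝ => Real.smoothTransition ((1 - s) / κ)) (‖x - y‖ ^ 2 / τ ^ 2)) *
        ∑ i : Fin 3, ‖G x (EuclideanSpace.single i (1:ℝ))‖ ^ 2 := by
      rw [← integral_const_mul]
      refine integral_congr_ae (Eventually.of_forall fun x => ?_)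
      simp only [mul_assoc]
    rw [hsplit]
    exact mul_nonneg_of_nonpos_of_nonpos (neg_nonpos.mpr (inv_nonneg.mpr (sq_nonneg τ))) (hRad τ hτ.1 hτ.2)

/-! ### §4 Monotonicity of `ρ ↦ ρ⁻¹·E(B_ρ)` from the radial inequality -/

/-- ★★★ **MONOTONICITY FROM THE RADIAL INEQUALITY.**  If the energy density `dens = Σᵢ‖G eᵢ‖²` is integrable on `B_ρ(y)` and the radial
inequality `∫_{B_ρ(y)} (g_κ + 2s·g_κ′)(‖x−y‖²∕τ²)·dens ≤ 0` holds for every cutoff parameter `κ ∈ (0,1)` and every scale `τ ∈ (0, ρ)`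
(this is the stationarity identity of [Simon1996, §2.2 (v)] tested against the radial fields `θ_τ(x)(x − y)`, summed over the axes —
the (δ1) «radial identity» of seat w2 g13 plus `g_κ′ ≤ 0`), then `σ⁻¹·E(B_σ(y)) ≤ ρ⁻¹·E(B_ρ(y))` for `0 < σ ≤ ρ` — the consequent of
the (M)-row `hMono` of ✓`PoincareLipschitzUniformSmallScaleEnergyOfRows`.  Proof: the weighted energies `φ_κ(τ) = τ⁻¹∫ g_κ(‖x−y‖²∕τ²)dens`
are non-decreasing on `(0, ρ)` (`weightedEnergy_monotoneOn`); sandwich `√(1−κ)·σ⁻¹E(B_σ) ≤ φ_κ(σ∕√(1−κ)) ≤ φ_κ(τ₁) ≤ τ₁⁻¹E(B_ρ)` and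
the scalar limits `τ₁ ↑ ρ`, `κ ↓ 0`. [cite: Simon1996, §2.4 (ii)] -/
theorem monotonicity_of_radialInequality (y : EuclideanSpace ℝ (Fin 3)) {ρ : ℝ} (hρ : 0 < ρ)
    (G : EuclideanSpace ℝ (Fin 3) → (EuclideanSpace ℝ (Fin 3) →L[ℝ] EuclideanSpace ℝ (Fin 4)))
    (hGi : IntegrableOn (fun x => ∑ i : Fin 3, ‖G x (EuclideanSpace.single i (1:ℝ))‖ ^ 2) (ball y ρ))
    (hRad : ∀ κ τ : ℝ, 0 < κ → κ < 1 → 0 < τ → τ < ρ →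
      ∫ x in ball y ρ, (Real.smoothTransition ((1 - ‖x - y‖ ^ 2 / τ ^ 2) / κ) +
          2 * (‖x - y‖ ^ 2 / τ ^ 2) * deriv (fun s : ℝ => Real.smoothTransition ((1 - s) / κ)) (‖x - y‖ ^ 2 / τ ^ 2)) *
        ∑ i : Fin 3, ‖G x (EuclideanSpace.single i (1:ℝ))‖ ^ 2 ≤ 0)
    (σ : ℝ) (hσ : 0 < σ) (hσρ : σ ≤ ρ) :
    σ⁻¹ * ∫ x in ball y σ, ∑ i : Fin 3, ‖G x (EuclideanSpace.single i (1:ℝ))‖ ^ 2 ≤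
      ρ⁻¹ * ∫ x in ball y ρ, ∑ i : Fin 3, ‖G x (EuclideanSpace.single i (1:ℝ))‖ ^ 2 := by
  rcases hσρ.eq_or_lt with h | hσρ'
  · rw [h]
  set dens : EuclideanSpace ℝ (Fin 3) → ℝ := fun x => ∑ i : Fin 3, ‖G x (EuclideanSpace.single i (1:ℝ))‖ ^ 2 with hdens
  have hdens_nn : ∀ x, 0 ≤ dens x := fun x => Finset.sum_nonneg fun i _ => by positivity
  set a : ℝ := ∫ x in ball y σ, dens x with ha
  set b : ℝ := ∫ x in ball y ρ, dens x with hb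
  have hb0 : 0 ≤ b := setIntegral_nonneg measurableSet_ball fun x _ => hdens_nn x
  -- the threshold `κ₀ := 1 − σ²∕ρ²`
  set κ₀ : ℝ := 1 - σ ^ 2 / ρ ^ 2 with hκ₀
  have hκ₀pos : 0 < κ₀ := by
    rw [hκ₀, sub_pos, div_lt_one (by positivity)]
    exact pow_lt_pow_left₀ hσρ' hσ.le two_ne_zero
  have hκ₀1 : κ₀ < 1 := by
    rw [hκ₀]; have : 0 < σ ^ 2 / ρ ^ 2 := by positivity
    linarith
  -- STEP 1: for `κ ∈ (0, κ₀)` and `τ₁ ∈ [σ∕√(1−κ), ρ)`: `√(1−κ)·σ⁻¹·a ≤ τ₁⁻¹·b`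
  have step1 : ∀ κ : ℝ, 0 < κ → κ < κ₀ → ∀ τ₁ : ℝ, σ / Real.sqrt (1 - κ) ≤ τ₁ → τ₁ < ρ →
      Real.sqrt (1 - κ) * (σ⁻¹ * a) ≤ τ₁⁻¹ * b := by
    intro κ hκ hκκ₀ τ₁ hτ₁ hτ₁ρ
    have hκ1 : κ < 1 := hκκ₀.trans hκ₀1
    have h1κ : 0 < 1 - κ := by linarith
    have hsq : 0 < Real.sqrt (1 - κ) := Real.sqrt_pos.mpr h1κ
    set σ' : ℝ := σ / Real.sqrt (1 - κ) with hσ'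
    have hσ'pos : 0 < σ' := div_pos hσ hsq
    have hσσ' : σ ≤ σ' := by
      rw [hσ', le_div_iff₀ hsq]
      calc σ * Real.sqrt (1 - κ) ≤ σ * 1 := by
            gcongr; rw [Real.sqrt_le_one]; linarith
        _ = σ := mul_one σ
    have hσ'ρ : σ' < ρ := by
      -- `σ'² = σ²∕(1−κ) < ρ²` iff `κ < κ₀`
      have h1 : σ' ^ 2 = σ ^ 2 / (1 - κ) := by
        rw [hσ', div_pow, Real.sq_sqrt h1κ.le]
      have h2 : σ ^ 2 / (1 - κ) < ρ ^ 2 := by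
        rw [div_lt_iff₀ h1κ]
        have h3 : σ ^ 2 / ρ ^ 2 < 1 - κ := by rw [hκ₀] at hκκ₀; linarith
        rw [div_lt_iff₀ (by positivity)] at h3
        linarith
      nlinarith [hσ'pos, hρ]
    have hτ₁pos : 0 < τ₁ := hσ'pos.trans_le hτ₁
    -- monotonicity of the weighted energy between `σ'` and `τ₁`
    have hmono := weightedEnergy_monotoneOn y hρ G hGi κ (fun τ hτ hτρ => hRad κ τ hκ hκ1 hτ hτρ)
      ⟨hσ'pos, hσ'ρ⟩ ⟨hτ₁pos, hτ₁ρ⟩ hτ₁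
    -- lower bound at `σ'`: the cutoff equals `1` on `B_σ(y)`
    have hlow : σ'⁻¹ * a ≤ ∫ x in ball y ρ, Real.smoothTransition ((1 - ‖x - y‖ ^ 2 / σ' ^ 2) / κ) * σ'⁻¹ * dens x := by
      have hsub : ball y σ ⊆ ball y ρ := ball_subset_ball hσρ'.le
      calc σ'⁻¹ * a = ∫ x in ball y σ, σ'⁻¹ * dens x := (integral_const_mul _ _).symm
        _ = ∫ x in ball y σ, Real.smoothTransition ((1 - ‖x - y‖ ^ 2 / σ' ^ 2) / κ) * σ'⁻¹ * dens x := by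
            refine setIntegral_congr_fun measurableSet_ball fun x hx => ?_
            have hxy : ‖x - y‖ < σ := by rwa [mem_ball, dist_eq_norm] at hx
            have hq : ‖x - y‖ ^ 2 / σ' ^ 2 ≤ 1 - κ := by
              rw [hσ', div_pow, Real.sq_sqrt h1κ.le, div_div_eq_mul_div, div_le_iff₀ (by positivity)]
              have : ‖x - y‖ ^ 2 ≤ σ ^ 2 := pow_le_pow_left₀ (norm_nonneg _) hxy.le 2
              nlinarith
            simp only [cutoff_eq_one hκ hq, one_mul]
        _ ≤ ∫ x in ball y ρ, Real.smoothTransition ((1 - ‖x - y‖ ^ 2 / σ' ^ 2) / κ) * σ'⁻¹ * dens x :=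
            setIntegral_mono_set (integrable_weighted y ρ G hGi κ σ')
              (Eventually.of_forall fun x => mul_nonneg (mul_nonneg (cutoff_mem_Icc κ _).1 (inv_nonneg.mpr hσ'pos.le))
                (hdens_nn x))
              (Eventually.of_forall hsub)
    -- upper bound at `τ₁`: the cutoff is at most `1`
    have hup : ∫ x in ball y ρ, Real.smoothTransition ((1 - ‖x - y‖ ^ 2 / τ₁ ^ 2) / κ) * τ₁⁻¹ * dens x ≤ τ₁⁻¹ * b := by
      calc ∫ x in ball y ρ, Real.smoothTransition ((1 - ‖x - y‖ ^ 2 / τ₁ ^ 2) / κ) * τ₁⁻¹ * dens x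
          ≤ ∫ x in ball y ρ, τ₁⁻¹ * dens x := by
            refine integral_mono_ae (integrable_weighted y ρ G hGi κ τ₁) (hGi.const_mul _)
              (Eventually.of_forall fun x => ?_)
            have h1 : Real.smoothTransition ((1 - ‖x - y‖ ^ 2 / τ₁ ^ 2) / κ) ≤ 1 := (cutoff_mem_Icc κ _).2
            have h2 : 0 ≤ τ₁⁻¹ * dens x := mul_nonneg (inv_nonneg.mpr hτ₁pos.le) (hdens_nn x)
            calc Real.smoothTransition ((1 - ‖x - y‖ ^ 2 / τ₁ ^ 2) / κ) * τ₁⁻¹ * dens x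
                = Real.smoothTransition ((1 - ‖x - y‖ ^ 2 / τ₁ ^ 2) / κ) * (τ₁⁻¹ * dens x) := by ring
              _ ≤ 1 * (τ₁⁻¹ * dens x) := by gcongr
              _ = τ₁⁻¹ * dens x := one_mul _
        _ = τ₁⁻¹ * b := integral_const_mul _ _
    have hchain := (hlow.trans hmono).trans hup
    -- `σ'⁻¹ = √(1−κ)∕σ`
    have hσ'inv : σ'⁻¹ = Real.sqrt (1 - κ) * σ⁻¹ := by
      rw [hσ', inv_div, div_eq_mul_inv]
    calc Real.sqrt (1 - κ) * (σ⁻¹ * a) = σ'⁻¹ * a := by rw [hσ'inv, mul_assoc]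
      _ ≤ τ₁⁻¹ * b := hchain
  -- STEP 2: `τ₁ ↑ ρ` for fixed `κ`
  have step2 : ∀ κ : ℝ, 0 < κ → κ < κ₀ → Real.sqrt (1 - κ) * (σ⁻¹ * a) ≤ ρ⁻¹ * b := by
    intro κ hκ hκκ₀
    have hκ1 : κ < 1 := hκκ₀.trans hκ₀1
    have hsq : 0 < Real.sqrt (1 - κ) := Real.sqrt_pos.mpr (by linarith)
    have hσ'ρ : σ / Real.sqrt (1 - κ) < ρ := by
      have h1κ : 0 < 1 - κ := by linarith
      rw [div_lt_iff₀ hsq]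
      have h3 : σ ^ 2 / ρ ^ 2 < 1 - κ := by rw [hκ₀] at hκκ₀; linarith
      rw [div_lt_iff₀ (by positivity)] at h3
      have h4 : σ ^ 2 < (ρ * Real.sqrt (1 - κ)) ^ 2 := by
        rw [mul_pow, Real.sq_sqrt h1κ.le]; linarith
      exact lt_of_pow_lt_pow_left₀ 2 (by positivity) h4
    have hlim : Tendsto (fun τ₁ : ℝ => τ₁⁻¹ * b) (𝓝[<] ρ) (𝓝 (ρ⁻¹ * b)) :=
      (((continuousAt_inv₀ hρ.ne').tendsto).mul_const b).mono_left nhdsWithin_le_nhds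
    refine ge_of_tendsto hlim ?_
    filter_upwards [Ico_mem_nhdsLT hσ'ρ] with τ₁ hτ₁
    exact step1 κ hκ hκκ₀ τ₁ hτ₁.1 hτ₁.2
  -- STEP 3: `κ ↓ 0`
  have hlim : Tendsto (fun κ : ℝ => Real.sqrt (1 - κ) * (σ⁻¹ * a)) (𝓝[>] 0) (𝓝 (Real.sqrt (1 - 0) * (σ⁻¹ * a))) :=
    ((((Real.continuous_sqrt.comp (continuous_const.sub continuous_id)).tendsto 0)).mul_const _).mono_left
      nhdsWithin_le_nhds
  rw [sub_zero, Real.sqrt_one, one_mul] at hlim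
  refine le_of_tendsto hlim ?_
  filter_upwards [Ioo_mem_nhdsGT hκ₀pos] with κ hκ
  exact step2 κ hκ.1 hκ.2

end Summit.QuantumFields.YangMills.Theorems.PoincareLipschitzMonotonicityOfRadialInequality

end
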